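import Mathlib
import HarnessLib
import Summits.CriticalPhenomena.CardyFormulaZ2.Theses.CardySelfRefinement
import Literature.Probability.RandomPlanarGeometry.ChordalReversibility
import Literature.Probability.RandomPlanarGeometry.ConformalRectangle
import Literature.Barriers.CriticalPhenomena.FKParafermionicHalfCauchyRiemann

/-!
# Sketch — crux idea `swallowing-skeleton-rs-pin` for `SymmetryUpgradeR` (stmt-CriticalPhenomena-17239)

First-lemma signatures only (crux-ideate: no skeleton). Everything is stated over existing declarations.

* `ClauseIV P` — hypotheses (iii)+(iv) of the crux, verbatim.
* `ReversibleOfClauseIV` — (FL1) reversibility of the limit family is FREE from (iv) (lattice reversal + the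
  primal/dual swap `flip ∘ shift (½,½)` of bond-ℤ² at `p = ½`).
* `TouchExponentOneThird P` — (FL2) the exact boundary-touch exponent `1/3` of the limit family, from (iv) +
  Ikhlef–Ponsaing 2012 (Prop. 4.7/4.9, the `qKZ` ground state of the TL(n=1) strip) + RSW quasi-multiplicativity.
* `SkeletonDetermined` — (FL3) hull trick (LSW / Lawler 2005 Prop. 6.32) + renewal at boundary-arc landings
  (`Negative.kernel_eq_of_jordan_remaining`, lemma L′): under conformal covariance the hitting function on
  conformal rectangles determines every first-passage range-avoidance law at boundary arcs.
* `ExitFunctionRigidity` — (FL4, the pin) conformal covariance + locality/TI/renewal + reversibility + touch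
  exponent `1/3` force the hitting function to be Cardy's.
-/

namespace Summit.CriticalPhenomena.CardyFormulaZ2.Cruxes.SymmetryUpgradeR.SwallowingSkeleton

open MeasureTheory Filter Set
open Literature.Probability.RandomPlanarGeometry Literature.Probability.LatticeModels
  Literature.Probability.Percolation

/-- Clauses (iii)+(iv) of `SymmetryUpgradeR`: interfaces eventually a.e.-measurable, and `P D` is the sequential
scaling limit of the bond-ℤ² (`p = ½`) exploration interfaces along ONE mesh sequence, for every Dobrushin domain
and every admissible ℤ²-discretisation family. -/
def ClauseIV (P : ChordalFamily) : Prop :=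
  (∀ (D : DobrushinDomain) (E : ℝ → DiscreteDobrushin), ZdDiscretisationFamily D E →
      ∀ᶠ δ in nhdsWithin (0 : ℝ) (Set.Ioi 0),
        AEMeasurable (bondInterfaceIn D (E δ)) (bondPercolation (zdGraph 2) half)) ∧
  ∃ δs : ℕ → ℝ, (∀ n, 0 < δs n) ∧ Tendsto δs atTop (nhds 0) ∧
    ∀ (D : DobrushinDomain) (E : ℝ → DiscreteDobrushin), ZdDiscretisationFamily D E →
      ∀ f : BoundedContinuousFunction (CurveClass ℂ) ℝ,
        Tendsto (fun n => ∫ ω, f (bondInterfaceIn D (E (δs n)) ω) ∂(bondPercolation (zdGraph 2) half))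
          atTop (nhds (∫ γ, f γ ∂(P D)))

/-- (FL1) Reversibility of the limit family is free from clause (iv): the `a → b` interface of `(D; a, b)` reversed is
the `b → a` interface of `(D; b, a)` with primal/dual boundary conditions exchanged, and the primal/dual swap
`ω ↦ (1 − ω) ∘ shift(½,½)` is an exact symmetry of bond-ℤ² at `p = ½` mapping admissible discretisation families
of `D` to admissible families of `D.swap`; both pass to the limit along the common mesh sequence. -/
def ReversibleOfClauseIV : Prop :=
  ∀ P : ChordalFamily, P.IsChordal → ClauseIV P → P.IsReversible

/-- (FL2) Exact boundary-touch exponent `1/3` of the limit family: for a boundary point `z` of the second arc, away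
from the marks, the probability that the curve comes `ε`-close to `z` is `≍ ε^{1/3}`. Source through (iv):
Ikhlef–Ponsaing 2012 Prop. 4.7 (`P_b^{(L)} = A_V(L) A_V(L+2) / N_8(L+1)²`, exact, `qKZ` at `q = e^{2πi/3}`)
and Prop. 4.9 (`P_b^{(L)} ∼ C L^{-1/3}`), transported from the strip to Jordan domains by RSW quasi-multiplicativity
of the half-plane one-arm event. For chordal SLE_κ the same exponent is `8/κ − 1` (Alberts–Sheffield), `= 1/3`
iff `κ = 6`. -/
def TouchExponentOneThird (P : ChordalFamily) : Prop :=
  ∀ D : DobrushinDomain, ∀ z ∈ D.arc 1, z ≠ D.pt 0 → z ≠ D.pt 1 →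
    ∃ c C ε₀ : ℝ, 0 < c ∧ 0 < ε₀ ∧ ∀ ε ∈ Set.Ioo 0 ε₀,
      c * ε ^ (1 / 3 : ℝ) ≤ (P D).real {γ | ∃ w ∈ γ.range, dist w z < ε} ∧
        (P D).real {γ | ∃ w ∈ γ.range, dist w z < ε} ≤ C * ε ^ (1 / 3 : ℝ)

/-- (FL3) Skeleton determination (first rung). Two conformally covariant local-Markov chordal families with the same
hitting function on conformal rectangles have the same range-avoidance laws for curves stopped at their first hit
of any closed boundary arc `F` (LSW hull trick: `P D (stopAt F avoids A) = P (D minus A) (hits F before A)` by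
`IsLocal`; conformal covariance turns the right-hand side into the hitting function of a conformal rectangle). -/
def SkeletonDetermined : Prop :=
  ∀ P P' : ChordalFamily, IsLocalMarkovChordalFamily P → IsLocalMarkovChordalFamily P' →
    P.IsConformallyCovariant → P'.IsConformallyCovariant →
    (∀ R : ConformalRectangle,
        P (R.chord 0 2 (by decide)) (CurveClass.hitsBefore (R.arc 2) (R.arc 1)) =
          P' (R.chord 0 2 (by decide)) (CurveClass.hitsBefore (R.arc 2) (R.arc 1))) →
    ∀ (D : DobrushinDomain) (F A : Set ℂ), IsClosed F → F ⊆ frontier D.carrier → IsClosed A →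
      P D {γ | Disjoint (γ.stopAt F).range A} = P' D {γ | Disjoint (γ.stopAt F).range A}

/-- (FL4, the pin) Exit-function rigidity. For a conformally covariant local-Markov chordal family the hitting
function of conformal rectangles is one function `F_P` of the cross-ratio; locality + target independence + renewal
at boundary-arc landings make the whole boundary-swallowing skeleton an `F_P`-functional (FL3), hence the touch
exponent a function of `F_P`; among the renewal-consistent exit functions (the restarted oblique-RBM family
`F_θ`, Lawler 2005 Prop. 6.37–6.39 / Dubédat 2004, is the conjectured complete list for achiral families) the touch
exponent `1/3` selects Cardy's. -/
def ExitFunctionRigidity : Prop :=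
  ∀ P : ChordalFamily, IsLocalMarkovChordalFamily P → P.IsConformallyCovariant → P.IsReversible →
    TouchExponentOneThird P →
    ∀ (R : ConformalRectangle) (φ : ConformalEquiv UpperHalfPlane.upperHalfPlaneSet R.carrier)
      (x : Fin 4 → ℝ), R.IsUniformizing φ x →
      (P (R.chord 0 2 (by decide))).real (CurveClass.hitsBefore (R.arc 2) (R.arc 1)) =
        cardyFunction (crossRatio x)

/-- Shape of the intended line (informal, not a skeleton): front end (shared, open) + FL4 + Camia–Newman template. -/
def LineShape : Prop :=
  (∀ P : ChordalFamily, IsLocalMarkovChordalFamily P → ClauseIV P → P.IsConformallyCovariant) →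
  ReversibleOfClauseIV → (∀ P : ChordalFamily, P.IsChordal → ClauseIV P → TouchExponentOneThird P) →
  ExitFunctionRigidity →
  Summit.CriticalPhenomena.CardyFormulaZ2.Theses.CardySelfRefinement.SymmetryUpgradeR

end Summit.CriticalPhenomena.CardyFormulaZ2.Cruxes.SymmetryUpgradeR.SwallowingSkeleton

/-!
## Second idea `zhou-rotation-split-audit` — the load-bearing finite claim of arXiv:2409.03235, typed abstractly

`ZhouSplitAt K d F p`: at the interior medial vertex `p` (distance `d p` from the boundary, in mesh units), the
function `F` on medial edges (clockwise corners `NW, NE, SE, SW` = `medialCornersAt p.1 p.2 0..3`) splits as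
`F = Ft + Fi` with BOTH pieces satisfying the exact vertex relation (`HalfCRRelationAt c`), `Ft` satisfying the
MISSING opposite-pairs relation `Ft(NW) + Ft(SE) = Ft(NE) + Ft(SW)` up to `K / d²`, and `Fi` the anti-relation
up to the same error (Zhou §1.3 p. 7, Prop. 4.1–4.2: "`F̃(A)+F̃(C) = F̃(B)+F̃(D)+O(δ²)` and
`F_i(A)+F_i(C) = −F_i(B)−F_i(D)+O(δ²)` when `v` is away from the boundary", error `(δ/d_v)²`).
-/

namespace Summit.CriticalPhenomena.CardyFormulaZ2.Cruxes.SymmetryUpgradeR.ZhouAudit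

open Literature.Probability.LatticeModels Literature.Barriers.CriticalPhenomena

/-- Zhou's claimed rotation split of the `q = 1` edge parafermion at one interior medial vertex, as a property of
an arbitrary function on medial edges (to be instantiated with the bond-ℤ² observable at mesh `δ`, spin `1/3`):
exact first relation for both halves, approximate second relation with defect `K / d²`. -/
def ZhouSplitAt (c : ℂ) (K : ℝ) (d : Site 2 × Fin 2 → ℝ) (F Ft Fi : Site 2 × Site 2 → ℂ)
    (p : Site 2 × Fin 2) : Prop :=
  (∀ k : Fin 4, F (medialCornersAt p.1 p.2 k) = Ft (medialCornersAt p.1 p.2 k) + Fi (medialCornersAt p.1 p.2 k)) ∧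
  HalfCRRelationAt c Ft p ∧ HalfCRRelationAt c Fi p ∧
  ‖Ft (medialCornersAt p.1 p.2 0) + Ft (medialCornersAt p.1 p.2 2)
      - Ft (medialCornersAt p.1 p.2 1) - Ft (medialCornersAt p.1 p.2 3)‖ ≤ K / d p ^ 2 ∧
  ‖Fi (medialCornersAt p.1 p.2 0) + Fi (medialCornersAt p.1 p.2 2)
      + Fi (medialCornersAt p.1 p.2 1) + Fi (medialCornersAt p.1 p.2 3)‖ ≤ K / d p ^ 2

/-- The global form on a discrete Dobrushin domain: one split serving every interior medial vertex, with a
domain-independent constant. This is the statement a refuter should test numerically (exact enumeration / MC of the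
edge observable on small boxes) and the one a prover would have to extract from Zhou's Props. 3.2, 3.6, 4.1, 4.2. -/
def ZhouSplit (c : ℂ) (K : ℝ) (D : DiscreteDobrushin) (d : Site 2 × Fin 2 → ℝ)
    (F : Site 2 × Site 2 → ℂ) : Prop :=
  ∃ Ft Fi : Site 2 × Site 2 → ℂ, ∀ p ∈ halfCREquations D, ZhouSplitAt c K d F Ft Fi p

end Summit.CriticalPhenomena.CardyFormulaZ2.Cruxes.SymmetryUpgradeR.ZhouAudit
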